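import Literature.Geometry.Riemannian.ExponentialMapDifferential
import HarnessLib

/-!
# Corner cutting: `d(exp_y(-s u), exp_y(s w)) < 2 s` for unit `u ≠ w` (Lee 2018, p. 168)

Third step towards the named fact `hopfRinow_compact` of `ExponentialMap.lean` (after
`HopfRinowCompact.lean` — the reduction `exists_isMinimizingUpTo_of_local` of Lee's
Lemma 6.18 (a) to two local statements (L1), (L2) — and `ExponentialMapDifferential.lean` —
`d(exp_y)_0 = id`). This file PROVES hypothesis (L2), the metric content of "a minimizing curve
has no corners" used on p. 168 of Lee's proof:

* `exists_ball_edist_extChartAt_symm_le` — **chart segments are short**: for `ρ > 1` and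
  `z₁, z₂` close to `φ y` in the chart `φ` at `y`, `d(φ⁻¹ z₁, φ⁻¹ z₂) ≤ ρ |z₂ - z₁|_{g_y}`
  (the sharp form of the local comparison of `d_g` with a Euclidean metric, Lee Lemma 2.53; the
  argument of Mathlib's `eventually_riemannianEDist_le_edist_extChartAt` with Mathlib's sharp
  `eventually_norm_symmL_trivializationAt_comp_self_lt`);
* `exists_edist_riemannianExpMap_lt_two_mul` — **corner cutting**: for `g_y`-unit `u ≠ w` in
  `E = T_yM` and all small `s > 0`, `d(exp_y(-s u), exp_y(s w)) < 2 s`, since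
  `φ(exp_y v) = φ y + v + o(|v|)` and `|u + w|_{g_y} < 2` (parallelogram law).

No definitions, no named facts (D-0026).

## References

* J. M. Lee, *Introduction to Riemannian Manifolds*, 2nd ed., GTM 176 (2018): Lemma 2.53,
  Prop. 5.19 (d), Lemma 6.18 (proof, p. 168). [LeeRiemannianManifolds2018]
-/

noncomputable section

open Bundle Set Filter Metric Manifold
open scoped Manifold ContDiff Topology

namespace Literature.Geometry.Riemannian

open Literature.Geometry.Lorentzian

/-! ### Corner cutting (the metric form of "minimizing curves have no corners") -/

section CornerCutting

open Literature.Geometry.Lorentzian.PseudoRiemannianMetric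
open scoped ENNReal

variable {E : Type*} [NormedAddCommGroup E] [NormedSpace ℝ E] {H : Type*} [TopologicalSpace H]
  {I : ModelWithCorners ℝ E H} {M : Type*} [TopologicalSpace M] [ChartedSpace H M]
  [IsManifold I ∞ M] {n : ℕ∞ω} [FiniteDimensional ℝ E]
  {g : PseudoRiemannianMetric I n E (TangentSpace I : M → Type _)}

omit [FiniteDimensional ℝ E] in
/-- The trivialisation of `TM` at `y` reads a tangent vector at `y` as itself (fibre-typed form of
`trivializationAt_snd_self`). [folklore] -/
theorem trivializationAt_snd_self' (y : M) (w : TangentSpace I y) :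
    (trivializationAt E (TangentSpace I) y (TotalSpace.mk' E y w)).2 = w :=
  tangentCoordChange_self (mem_extChartAt_source y)

/-- **Chart segments are short**: near `y`, the Riemannian distance between two points of the
chart at `y` is at most `ρ` times the `g_y`-length of the chart segment joining them, for any
`ρ > 1`: `d(φ⁻¹ z₁, φ⁻¹ z₂) ≤ ρ |z₂ - z₁|_{g_y}` for `z₁, z₂` in a small ball around `φ y`
(`φ = extChartAt I y`). The distance is bounded by the length of the curve
`t ↦ φ⁻¹(z₁ + t (z₂ - z₁))`, whose speed `|dφ⁻¹(z₂ - z₁)|_g` is at most `ρ |z₂ - z₁|_{g_y}`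
close to `y` by continuity of the metric (Mathlib's
`eventually_norm_symmL_trivializationAt_comp_self_lt`; the argument of Mathlib's
`eventually_riemannianEDist_le_edist_extChartAt` with the sharp constant). This is the local
comparison `d_g ≤ c d_ḡ` with a Euclidean metric in a chart (Lee 2018, Lemma 2.53 and
Prop. 2.51 (2.21)), in sharp form. [cite: LeeRiemannianManifolds2018, Lemma 2.53] -/
theorem exists_ball_edist_extChartAt_symm_le (hg : g.IsRiemannian) (y : M) {ρ : ℝ} (hρ : 1 < ρ) :
    ∃ θ > (0 : ℝ), ball (extChartAt I y y) θ ∩ range I ⊆ (extChartAt I y).target ∧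
      ∀ z₁ ∈ ball (extChartAt I y y) θ ∩ range I, ∀ z₂ ∈ ball (extChartAt I y y) θ ∩ range I,
        g.edist hg ((extChartAt I y).symm z₁) ((extChartAt I y).symm z₂) ≤
          ENNReal.ofReal (ρ * Real.sqrt (g.val y (z₂ - z₁ :) (z₂ - z₁ :))) := by
  letI := g.riemannianBundle hg
  haveI := g.isContinuousRiemannianBundle hg
  -- (1) the sharp bound on `dφ⁻¹` near `y`, composed with the (identity) trivialisation at `y`
  have h1 : ∀ᶠ y' in 𝓝 y, ‖((trivializationAt E (TangentSpace I : M → Type _) y).symmL ℝ y') ∘L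
      ((trivializationAt E (TangentSpace I : M → Type _) y).continuousLinearMapAt ℝ y)‖ < ρ :=
    eventually_norm_symmL_trivializationAt_comp_self_lt E (fun x : M => TangentSpace I x) y hρ
  have h2 : ∀ᶠ y' in 𝓝 y,
      ‖((mfderivWithin 𝓘(ℝ, E) I (extChartAt I y).symm (range I) (extChartAt I y y')) ∘L
        ((trivializationAt E (TangentSpace I : M → Type _) y).continuousLinearMapAt ℝ y) :
          TangentSpace I y →L[ℝ] TangentSpace I y')‖ < ρ := by
    filter_upwards [h1, chart_source_mem_nhds H y] with y' hy' h'y'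
    rwa [TangentBundle.symmL_trivializationAt h'y'] at hy'
  have h3 : ∀ᶠ z in 𝓝[range I] (extChartAt I y y),
      ‖((mfderivWithin 𝓘(ℝ, E) I (extChartAt I y).symm (range I) z) ∘L
        ((trivializationAt E (TangentSpace I : M → Type _) y).continuousLinearMapAt ℝ y) :
          TangentSpace I y →L[ℝ] TangentSpace I ((extChartAt I y).symm z))‖ < ρ := by
    have hy : 𝓝 y = 𝓝 ((extChartAt I y).symm (extChartAt I y y)) := by rw [extChartAt_to_inv]
    rw [hy] at h2
    have hca : ContinuousAt (extChartAt I y).symm (extChartAt I y y) :=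
      continuousAt_extChartAt_symm y
    filter_upwards [nhdsWithin_le_nhds (hca.preimage_mem_nhds h2),
      extChartAt_target_mem_nhdsWithin y] with z hz h'z
    have hzz : extChartAt I y ((extChartAt I y).symm z) = z := (extChartAt I y).right_inv h'z
    simp only [mem_preimage, mem_setOf_eq] at hz
    rwa [hzz] at hz
  obtain ⟨θ, hθ, hsub⟩ : ∃ θ > 0, ball (extChartAt I y y) θ ∩ range I ⊆ (extChartAt I y).target ∩
      {z | ‖((mfderivWithin 𝓘(ℝ, E) I (extChartAt I y).symm (range I) z) ∘L
        ((trivializationAt E (TangentSpace I : M → Type _) y).continuousLinearMapAt ℝ y) :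
          TangentSpace I y →L[ℝ] TangentSpace I ((extChartAt I y).symm z))‖ < ρ} :=
    mem_nhdsWithin_iff.1 (inter_mem (extChartAt_target_mem_nhdsWithin y) h3)
  refine ⟨θ, hθ, fun z hz => (hsub hz).1, fun z₁ hz₁ z₂ hz₂ => ?_⟩
  -- the trivialisation at `y` is the identity on `T_yM`, so `|dφ⁻¹ ξ| ≤ ρ |ξ|_{g_y}`
  have hmem : y ∈ (trivializationAt E (TangentSpace I : M → Type _) y).baseSet := by
    rw [TangentBundle.trivializationAt_baseSet]
    exact mem_chart_source H y
  have hB : ∀ ξ : TangentSpace I y,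
      ((trivializationAt E (TangentSpace I : M → Type _) y).continuousLinearMapAt ℝ y) ξ = ξ :=
    fun ξ =>
    (Trivialization.continuousLinearMapAt_apply_of_mem ℝ _ hmem ξ).trans
      (trivializationAt_snd_self' y ξ)
  have hbound : ∀ z ∈ ball (extChartAt I y y) θ ∩ range I, ∀ x : TangentSpace I y,
      ‖(mfderivWithin 𝓘(ℝ, E) I (extChartAt I y).symm (range I) z x :
        TangentSpace I ((extChartAt I y).symm z))‖ ≤ ρ * ‖x‖ := by
    intro z hz x
    have hlt := (hsub hz).2
    simp only [mem_setOf_eq] at hlt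
    have heq : (mfderivWithin 𝓘(ℝ, E) I (extChartAt I y).symm (range I) z x :
        TangentSpace I ((extChartAt I y).symm z)) =
        ((mfderivWithin 𝓘(ℝ, E) I (extChartAt I y).symm (range I) z) ∘L
          ((trivializationAt E (TangentSpace I : M → Type _) y).continuousLinearMapAt ℝ y) :
          TangentSpace I y →L[ℝ] TangentSpace I ((extChartAt I y).symm z)) x := by
      show _ = (mfderivWithin 𝓘(ℝ, E) I (extChartAt I y).symm (range I) z)
        (((trivializationAt E (TangentSpace I : M → Type _) y).continuousLinearMapAt ℝ y) x)
      rw [hB]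
    rw [heq]
    exact (ContinuousLinearMap.le_opNorm _ x).trans
      (mul_le_mul_of_nonneg_right hlt.le (norm_nonneg x))
  -- (2) the chart segment from `z₁` to `z₂`
  have hconv : Convex ℝ (ball (extChartAt I y y) θ ∩ range I) :=
    (convex_ball _ _).inter I.convex_range
  have hseg : ∀ t ∈ Icc (0 : ℝ) 1, z₁ + t • (z₂ - z₁) ∈ ball (extChartAt I y y) θ ∩ range I := by
    intro t ht
    have h := hconv hz₁ hz₂ (sub_nonneg.2 ht.2) ht.1 (by ring)
    have hηt : z₁ + t • (z₂ - z₁) = (1 - t) • z₁ + t • z₂ := by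
      simp only [smul_sub, sub_smul, one_smul]
      abel
    rwa [hηt]
  have hηd : ∀ t, HasDerivAt (fun t : ℝ => z₁ + t • (z₂ - z₁)) (z₂ - z₁) t := fun t => by
    have h := ((hasDerivAt_id t).smul_const (z₂ - z₁)).const_add z₁
    simpa using h
  have hηC : ContMDiff 𝓘(ℝ, ℝ) 𝓘(ℝ, E) 1 (fun t : ℝ => z₁ + t • (z₂ - z₁)) := by
    rw [contMDiff_iff_contDiff]
    exact contDiff_const.add (contDiff_id.smul contDiff_const)
  have hγC : ContMDiffOn 𝓘(ℝ, ℝ) I 1 ((extChartAt I y).symm ∘ fun t : ℝ => z₁ + t • (z₂ - z₁))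
      (Icc 0 1) :=
    (contMDiffOn_extChartAt_symm y).comp hηC.contMDiffOn fun t ht => (hsub (hseg t ht)).1
  have hγ0 : ((extChartAt I y).symm ∘ fun t : ℝ => z₁ + t • (z₂ - z₁)) 0 =
      (extChartAt I y).symm z₁ := by simp
  have hγ1 : ((extChartAt I y).symm ∘ fun t : ℝ => z₁ + t • (z₂ - z₁)) 1 =
      (extChartAt I y).symm z₂ := by simp
  -- (3) distance ≤ length ≤ `ρ |z₂ - z₁|_{g_y}`
  have hle : g.edist hg ((extChartAt I y).symm z₁) ((extChartAt I y).symm z₂) ≤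
      g.length hg ((extChartAt I y).symm ∘ fun t : ℝ => z₁ + t • (z₂ - z₁)) 0 1 := by
    rw [← hγ0, ← hγ1]
    exact edist_le_length hg zero_le_one hγC
  refine hle.trans ?_
  have hderiv : ∀ t ∈ Icc (0 : ℝ) 1,
      mfderivWithin 𝓘(ℝ, ℝ) I ((extChartAt I y).symm ∘ fun t : ℝ => z₁ + t • (z₂ - z₁))
        (Icc 0 1) t 1 =
      mfderivWithin 𝓘(ℝ, E) I (extChartAt I y).symm (range I) (z₁ + t • (z₂ - z₁)) (z₂ - z₁) := by
    intro t ht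
    have hφ' : HasMFDerivWithinAt 𝓘(ℝ, E) I (extChartAt I y).symm (range I) (z₁ + t • (z₂ - z₁))
        (mfderivWithin 𝓘(ℝ, E) I (extChartAt I y).symm (range I) (z₁ + t • (z₂ - z₁))) :=
      (mdifferentiableWithinAt_extChartAt_symm (hsub (hseg t ht)).1).hasMFDerivWithinAt
    have hη' : HasMFDerivWithinAt 𝓘(ℝ, ℝ) 𝓘(ℝ, E) (fun t : ℝ => z₁ + t • (z₂ - z₁)) (Icc 0 1) t
        ((1 : ℝ →L[ℝ] ℝ).smulRight (z₂ - z₁)) :=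
      (hasMFDerivAt_iff_hasFDerivAt.2 (hηd t).hasFDerivAt).hasMFDerivWithinAt
    have hcomp := hφ'.comp t hη'
      (show Icc (0 : ℝ) 1 ⊆ (fun t : ℝ => z₁ + t • (z₂ - z₁)) ⁻¹' range I from
        fun t' ht' => (hseg t' ht').2)
    have hU : UniqueMDiffWithinAt 𝓘(ℝ, ℝ) (Icc (0 : ℝ) 1) t := by
      rw [uniqueMDiffWithinAt_iff_uniqueDiffWithinAt]
      exact uniqueDiffOn_Icc zero_lt_one t ht
    rw [hcomp.mfderivWithin hU]
    show (mfderivWithin 𝓘(ℝ, E) I (extChartAt I y).symm (range I) (z₁ + t • (z₂ - z₁)))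
      (((1 : ℝ →L[ℝ] ℝ) (1 : ℝ)) • (z₂ - z₁)) = _
    rw [one_apply_eq_self, one_smul]
  have hlen : g.length hg ((extChartAt I y).symm ∘ fun t : ℝ => z₁ + t • (z₂ - z₁)) 0 1 =
      ∫⁻ t in Icc (0 : ℝ) 1, ‖mfderivWithin 𝓘(ℝ, ℝ) I
        ((extChartAt I y).symm ∘ fun t : ℝ => z₁ + t • (z₂ - z₁)) (Icc 0 1) t 1‖ₑ :=
    pathELength_eq_lintegral_mfderivWithin_Icc
  have hnorm : @norm (TangentSpace I y) _ (z₂ - z₁ :) = Real.sqrt (g.val y (z₂ - z₁ :) (z₂ - z₁ :)) :=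
    g.norm_eq_sqrt hg y (z₂ - z₁ :)
  rw [hlen, ← hnorm]
  calc ∫⁻ t in Icc (0 : ℝ) 1, ‖mfderivWithin 𝓘(ℝ, ℝ) I
        ((extChartAt I y).symm ∘ fun t : ℝ => z₁ + t • (z₂ - z₁)) (Icc 0 1) t 1‖ₑ
      ≤ ∫⁻ _ in Icc (0 : ℝ) 1, ENNReal.ofReal (ρ * @norm (TangentSpace I y) _ (z₂ - z₁ :)) := by
        refine MeasureTheory.setLIntegral_mono' measurableSet_Icc fun t ht => ?_
        rw [hderiv t ht, ← ofReal_norm]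
        exact ENNReal.ofReal_le_ofReal (hbound _ (hseg t ht) (z₂ - z₁ :))
    _ = ENNReal.ofReal (ρ * @norm (TangentSpace I y) _ (z₂ - z₁ :)) := by
        rw [MeasureTheory.setLIntegral_const, Real.volume_Icc, sub_zero, ENNReal.ofReal_one,
          mul_one]

variable [CompleteSpace E] [T2Space M] [BoundarylessManifold I M] [g.HasLeviCivita]
  [CovariantDerivative.ContMDiffCovariantDerivative g.leviCivita 1]

/-- **Corner cutting** (the metric content of "a minimizing curve has no corners", Lee 2018,
p. 168, there deduced from Thm. 6.4): for `g_y`-unit vectors `u ≠ w` at `y`, the broken geodesic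
entering `y` with velocity `u` and leaving with velocity `w` can be shortened near the corner,
`d(exp_y(-s u), exp_y(s w)) < 2s` for all small `s > 0`. Proof: in the chart `φ` at `y`,
`φ(exp_y v) = φ y + v + o(|v|)` (`d(exp_y)_0 = id`, Lee Prop. 5.19 (d);
`exists_ball_contDiffOn_extChartAt_expMap`), the chart segment between the two points has
`g`-length at most `ρ |φ(exp_y(sw)) - φ(exp_y(-su))|_{g_y} ≤ ρ (s |u + w|_{g_y} + o(s))` for any
`ρ > 1` (`exists_ball_edist_extChartAt_symm_le`), and `|u + w|_{g_y} < 2` for unit `u ≠ w`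
(parallelogram law). This is hypothesis (L2) of `exists_isMinimizingUpTo_of_local`
(`HopfRinowCompact.lean`); the vectors are taken in the model fibre `E = T_yM`.
[cite: LeeRiemannianManifolds2018, Lemma 6.18 (a) (proof, p. 168) and Prop. 5.19 (d)] -/
theorem exists_edist_riemannianExpMap_lt_two_mul (hg : g.IsRiemannian)
    (hc : IsGeodesicallyComplete g.leviCivita) (y : M) {u w : E}
    (hu : g.val y u u = 1) (hw : g.val y w w = 1) (huw : u ≠ w) :
    ∃ s₀ > (0 : ℝ), ∀ s : ℝ, 0 < s → s < s₀ →
      g.edist hg (riemannianExpMap g y (show TangentSpace I y from (-s) • u))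
        (riemannianExpMap g y (show TangentSpace I y from s • w)) < ENNReal.ofReal (2 * s) := by
  letI := g.riemannianBundle hg
  haveI := g.isContinuousRiemannianBundle hg
  /- the identification `S : E →L T_yM` given by the inverse trivialisation at `y` -/
  have hmem : y ∈ (trivializationAt E (TangentSpace I : M → Type _) y).baseSet := by
    rw [TangentBundle.trivializationAt_baseSet]
    exact mem_chart_source H y
  set S : E →L[ℝ] TangentSpace I y := (trivializationAt E (TangentSpace I : M → Type _) y).symmL ℝ y
    with hSdef
  have hB : ∀ v : TangentSpace I y,
      ((trivializationAt E (TangentSpace I : M → Type _) y).continuousLinearMapAt ℝ y) v = v :=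
    fun v => (Trivialization.continuousLinearMapAt_apply_of_mem ℝ _ hmem v).trans
      (trivializationAt_snd_self' y v)
  have hS : ∀ v : TangentSpace I y, S v = v := fun v => by
    have h := (trivializationAt E (TangentSpace I : M → Type _) y).symmL_continuousLinearMapAt
      (R := ℝ) hmem v
    rwa [hB v] at h
  have hSnorm : ∀ v : E, ‖S v‖ = Real.sqrt (g.val y v v) := fun v => by
    rw [hS]
    exact g.norm_eq_sqrt hg y v
  /- `m = |u + w|_{g_y} < 2` for unit `u ≠ w` (parallelogram law in `T_yM`) -/
  have hu1 : ‖S u‖ = 1 := by rw [hSnorm, hu, Real.sqrt_one]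
  have hw1 : ‖S w‖ = 1 := by rw [hSnorm, hw, Real.sqrt_one]
  have hm2 : ‖S (u + w)‖ < 2 := by
    have hpar := parallelogram_law_with_norm_mul ℝ (S u) (S w)
    have hne : S u - S w ≠ 0 := by
      rw [← map_sub, hS]
      exact sub_ne_zero.2 huw
    have hpos : 0 < ‖S u - S w‖ := norm_pos_iff.2 hne
    rw [hu1, hw1] at hpar
    have hlt : ‖S u + S w‖ * ‖S u + S w‖ < 2 * 2 := by nlinarith
    rw [map_add]
    by_contra h
    have h' : 2 ≤ ‖S u + S w‖ := not_lt.1 h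
    nlinarith [norm_nonneg (S u + S w)]
  set m : ℝ := ‖S (u + w)‖ with hm
  have hm0 : 0 ≤ m := norm_nonneg _
  /- constants -/
  set K : ℝ := ‖S‖ with hK
  have hK0 : 0 ≤ K := by rw [hK]; exact norm_nonneg S
  set U : ℝ := ‖u‖ + ‖w‖ + 1 with hU
  have hU0 : 0 < U := by positivity
  have huU : ‖u‖ ≤ U := by rw [hU]; linarith [norm_nonneg w]
  have hwU : ‖w‖ ≤ U := by rw [hU]; linarith [norm_nonneg u]
  set τ : ℝ := (2 - m) / (4 * (K * U + 1)) with hτ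
  have hKU : 0 < K * U + 1 := by positivity
  have hτ0 : 0 < τ := div_pos (by linarith) (by positivity)
  -- `m' = m + 2 K τ U ≤ m + (2 - m)/2 < 2`
  set m' : ℝ := m + 2 * (K * τ * U) with hm'
  have hm'2 : m' < 2 := by
    have h1 : K * τ * U = (K * U) * ((2 - m) / (4 * (K * U + 1))) := by rw [hτ]; ring
    have h2 : (K * U) * ((2 - m) / (4 * (K * U + 1))) ≤ (2 - m) / 4 := by
      rw [mul_div_assoc', div_le_div_iff₀ (by positivity) (by norm_num)]
      nlinarith [mul_nonneg hK0 hU0.le]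
    rw [hm', h1]
    linarith
  have hm'0 : 0 ≤ m' := by
    rw [hm']
    have : 0 ≤ K * τ * U := by positivity
    linarith
  set ρ : ℝ := 4 / (2 + m') with hρ
  have hρ1 : 1 < ρ := by
    rw [hρ, lt_div_iff₀ (by linarith)]
    linarith
  have hρm : ρ * m' < 2 := by
    rw [hρ, div_mul_eq_mul_div, div_lt_iff₀ (by linarith)]
    linarith
  have hρ0 : 0 < ρ := zero_lt_one.trans hρ1
  /- the local data: `exp` in the chart, and short chart segments -/
  obtain ⟨r₁, hr₁, hsrc, -, hfd⟩ :=
    exists_ball_contDiffOn_extChartAt_expMap (cov := g.leviCivita) hc y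
  obtain ⟨θ, hθ, -, hdist⟩ := exists_ball_edist_extChartAt_symm_le hg y hρ1
  -- `φ(exp_y v) = φ y + v + o(|v|)`
  have hf0 : extChartAt I y (expMap g.leviCivita y (show TangentSpace I y from (0 : E))) =
      extChartAt I y y := by
    rw [show (show TangentSpace I y from (0 : E)) = (0 : TangentSpace I y) from rfl,
      expMap_zero (cov := g.leviCivita) y]
  obtain ⟨ϑ, hϑ, hlin⟩ : ∃ ϑ > (0 : ℝ), ∀ v : E, ‖v‖ < ϑ →
      ‖extChartAt I y (expMap g.leviCivita y (show TangentSpace I y from v)) - extChartAt I y y - v‖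
        ≤ τ * ‖v‖ := by
    have h := hfd.isLittleO.def hτ0
    simp only [sub_zero, ContinuousLinearMap.coe_id', id_eq, hf0] at h
    obtain ⟨ϑ, hϑ, h'⟩ := Metric.eventually_nhds_iff.1 h
    exact ⟨ϑ, hϑ, fun v hv => h' (by simpa using hv)⟩
  /- the radius `s₀` -/
  set c₀ : ℝ := min ϑ (min r₁ (θ / (1 + τ))) with hc₀
  have hc₀0 : 0 < c₀ := lt_min hϑ (lt_min hr₁ (div_pos hθ (by linarith)))
  refine ⟨c₀ / U, div_pos hc₀0 hU0, fun s hs hsU => ?_⟩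
  have hsc₀ : s * U < c₀ := (lt_div_iff₀ hU0).1 hsU
  have hc₀ϑ : c₀ ≤ ϑ := min_le_left _ _
  have hc₀r : c₀ ≤ r₁ := (min_le_right _ _).trans (min_le_left _ _)
  have hc₀θ : c₀ ≤ θ / (1 + τ) := (min_le_right _ _).trans (min_le_right _ _)
  -- sizes of `a = -s u`, `b = s w`
  have hbsize : ‖s • w‖ ≤ s * U := by
    rw [norm_smul, Real.norm_of_nonneg hs.le]
    exact mul_le_mul_of_nonneg_left hwU hs.le
  have hasize : ‖(-s) • u‖ ≤ s * U := by
    rw [neg_smul, norm_neg, norm_smul, Real.norm_of_nonneg hs.le]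
    exact mul_le_mul_of_nonneg_left huU hs.le
  -- points of the chart: in the source, in the small ball, with linearisation error `≤ τ |v|`
  have hgood : ∀ v : E, ‖v‖ < c₀ →
      expMap g.leviCivita y (show TangentSpace I y from v) ∈ (extChartAt I y).source ∧
      extChartAt I y (expMap g.leviCivita y (show TangentSpace I y from v)) ∈
        ball (extChartAt I y y) θ ∩ range I ∧
      ‖extChartAt I y (expMap g.leviCivita y (show TangentSpace I y from v)) - extChartAt I y y - v‖
        ≤ τ * ‖v‖ := by
    intro v hv
    have h1 := hsrc v (hv.trans_le hc₀r)
    have h3 := hlin v (hv.trans_le hc₀ϑ)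
    refine ⟨h1, ⟨?_, extChartAt_target_subset_range y ((extChartAt I y).map_source h1)⟩, h3⟩
    rw [mem_ball, dist_eq_norm]
    have h4 : ‖extChartAt I y (expMap g.leviCivita y (show TangentSpace I y from v)) -
        extChartAt I y y‖ ≤ (1 + τ) * ‖v‖ := by
      calc ‖extChartAt I y (expMap g.leviCivita y (show TangentSpace I y from v)) - extChartAt I y y‖
          = ‖(extChartAt I y (expMap g.leviCivita y (show TangentSpace I y from v)) -
              extChartAt I y y - v) + v‖ := by rw [sub_add_cancel]
        _ ≤ τ * ‖v‖ + ‖v‖ := (norm_add_le _ _).trans (add_le_add h3 le_rfl)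
        _ = (1 + τ) * ‖v‖ := by ring
    have h5 : (1 + τ) * ‖v‖ < (1 + τ) * c₀ := mul_lt_mul_of_pos_left hv (by linarith)
    have h6 : (1 + τ) * c₀ ≤ θ := by
      rw [← le_div_iff₀' (by linarith : (0:ℝ) < 1 + τ)]
      exact hc₀θ
    linarith
  obtain ⟨ha_src, ha_ball, ha_lin⟩ := hgood ((-s) • u) (hasize.trans_lt hsc₀)
  obtain ⟨hb_src, hb_ball, hb_lin⟩ := hgood (s • w) (hbsize.trans_lt hsc₀)
  -- rewrite the two exponentials through the chart
  have ha_eq : riemannianExpMap g y (show TangentSpace I y from (-s) • u) =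
      (extChartAt I y).symm (extChartAt I y (expMap g.leviCivita y
        (show TangentSpace I y from (-s) • u))) :=
    ((extChartAt I y).left_inv ha_src).symm
  have hb_eq : riemannianExpMap g y (show TangentSpace I y from s • w) =
      (extChartAt I y).symm (extChartAt I y (expMap g.leviCivita y
        (show TangentSpace I y from s • w))) :=
    ((extChartAt I y).left_inv hb_src).symm
  rw [ha_eq, hb_eq]
  refine (hdist _ ha_ball _ hb_ball).trans_lt ?_
  rw [ENNReal.ofReal_lt_ofReal_iff (by linarith)]
  -- the chord: `φ(exp b) - φ(exp a) = s (u + w) + (e_b - e_a)`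
  set za := extChartAt I y (expMap g.leviCivita y (show TangentSpace I y from (-s) • u)) with hza
  set zb := extChartAt I y (expMap g.leviCivita y (show TangentSpace I y from s • w)) with hzb
  have hdecomp : zb - za = s • (u + w) +
      ((zb - extChartAt I y y - s • w) - (za - extChartAt I y y - (-s) • u)) := by
    simp only [smul_add, neg_smul]
    abel
  have herr : ‖S ((zb - extChartAt I y y - s • w) - (za - extChartAt I y y - (-s) • u))‖ ≤
      2 * (K * τ * U) * s := by
    refine (S.le_opNorm _).trans ?_
    have h1 : ‖(zb - extChartAt I y y - s • w) - (za - extChartAt I y y - (-s) • u)‖ ≤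
        τ * (s * U) + τ * (s * U) :=
      (norm_sub_le _ _).trans (add_le_add
        (hb_lin.trans (mul_le_mul_of_nonneg_left hbsize hτ0.le))
        (ha_lin.trans (mul_le_mul_of_nonneg_left hasize hτ0.le)))
    calc ‖S‖ * ‖(zb - extChartAt I y y - s • w) - (za - extChartAt I y y - (-s) • u)‖
        ≤ K * (τ * (s * U) + τ * (s * U)) := mul_le_mul_of_nonneg_left h1 hK0
      _ = 2 * (K * τ * U) * s := by ring
  have hNchord : ‖S (zb - za)‖ ≤ s * m' := by
    rw [hdecomp, map_add, map_smul]
    refine (norm_add_le _ _).trans ?_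
    rw [norm_smul, Real.norm_of_nonneg hs.le, hm']
    nlinarith [herr]
  rw [← hSnorm (zb - za)]
  calc ρ * ‖S (zb - za)‖ ≤ ρ * (s * m') := mul_le_mul_of_nonneg_left hNchord hρ0.le
    _ = (ρ * m') * s := by ring
    _ < 2 * s := mul_lt_mul_of_pos_right hρm hs

end CornerCutting

end Literature.Geometry.Riemannian
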